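import Summits.AtomisticToContinuum.HydrodynamicLimit.Theorems.TwoClocksEquilibriumFastWindowLDBirthT12DipoleComm
import Summits.AtomisticToContinuum.HydrodynamicLimit.Theorems.TwoClocksEquilibriumFastWindowLDBirthT12ZonalCommB
import Literature.Analysis.UnboundedOperators.LinearizedBoltzmannBddAboveProofs
import HarnessLib

/-!
# The dipole part: API, the `ℓ ≥ 2` remainder `Π_{≥2} = 1 - Π₀ - Π₁` commutes with `L`,
# `M`-orthogonality bookkeeping of `Π₁` and `Π_{≥2}`
# (helpers `t12_hardSphereLinearizedOp_higherPart_comm` (Z2''), `t12_dipolePart_orthogonal_collisionInvariants`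
# (Z4') of the line `birth`, crux `TwoClocks.EquilibriumFastWindowLD`, stmt-AtomisticToContinuum-14440;
# companion of `…T12DipoleComm` — infrastructure file 5 of the analytic residue
# `t12_logLinearPreimage_and_dipoleModulus`)

Sibling of `TwoClocksEquilibriumFastWindowLDBirthT12DipoleComm` (Z2: the dipole projection
`Π₁ψ(v) = ⟪Φ_ψ(|v|), v⟫ = dipolePart ψ v` commutes with the linearised hard-sphere operator `L` on
measurable functions of Gaussian growth, via the character-weighted orbit average
`Π₁ψ(v) = 3∫_{O(3)} χ(R) ψ(R⁻¹v) dR`). This file adds the bookkeeping that the sector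
decomposition `ψ = Π₀ψ + Π₁ψ + Π_{≥2}ψ` of the corrector plan uses around Z1/Z2:

* the algebra of `Π₁`: idempotence, `Π₁Π₀ = Π₀Π₁ = 0`, oddness, homogeneity / additivity, the sup
  bound `|Π₁ψ(v)| ≤ 3 sup_{|u|=|v|}|ψ|` and its Gaussian-growth form (constant `3C`),
  measurability, `Π₁(ψ - Π₁ψ) = 0`;
* the **higher (`ℓ ≥ 2`) part** `Π_{≥2}ψ := ψ - Π₀ψ - Π₁ψ` (`higherPart`): it has neither zonal
  nor dipole component (`zonalAvg_higherPart`, `dipolePart_higherPart`), Gaussian growth with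
  constant `5C`, and **`L` commutes with it** (`hardSphereLinearizedOp_higherPart`; registered form
  `t12_hardSphereLinearizedOp_higherPart_comm`, projections unfolded) — so `u := Π_{≥2}ψ` solves
  `Lu = Π_{≥2}g` exactly, the starting point of the far-field iteration of the plan (§6);
* **Z4'** (`t12_dipolePart_orthogonal_collisionInvariants`, registered): `Π₁` preserves
  `M`-orthogonality to `span{1, v, |v|²}`. Mechanism: `⟪Π₁ψ, φ⟫_M = 0` for radial `φ` by parity
  (`Π₁ψ` is odd), and **`⟪Π₁ψ, ⟪b, ·⟫⟫_M = ⟪ψ, ⟪b, ·⟫⟫_M`** (`maxwellianInner_dipolePart_inner`):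
  orbit form, Fubini in `dM dR`, invariance of `M` under `R⁻¹`
  (`∫ ψ(R⁻¹v)⟪b, v⟫ dM = ⟪m_ψ, R⁻¹b⟫`, `m_ψ = ∫ ψ(u) u dM`), and the orbit form once more for the
  LINEAR function `⟪m_ψ, ·⟫` at the point `b` (`3∫ χ(R) ⟪m_ψ, R⁻¹b⟫ dR = Π₁⟪m_ψ, ·⟫(b) = ⟪m_ψ, b⟫`)
  — Schur orthogonality `3∫ χ(R) R dR = 1` without computing it;
* consequently `Π_{≥2}ψ ⊥_M span{1, v, |v|²}` for EVERY `ψ` of the class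
  (`maxwellianInner_higherPart_collisionInvariant`).

References: Cercignani–Illner–Pulvirenti 1994 §7.3 p. 209 (isotropy); Grad 1963 §4 (sectors).
-/
noncomputable section

open MeasureTheory ProbabilityTheory Real Set Filter Metric TopologicalSpace
open scoped ENNReal BigOperators InnerProductSpace

namespace Summit.AtomisticToContinuum.HydrodynamicLimit.Theorems.ClampedCorrectorBirth

open Literature.Analysis.FluidPDE Literature.MathematicalPhysics.KineticTheory
open Literature.Analysis.UnboundedOperators

attribute [local instance] continuousStar_clm compactSpace_unitary_clm isProbabilityMeasure_haarO3

/-! ### The dipole part: algebra, bounds, measurability -/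

/-- Idempotence `Π₁ Π₁ = Π₁`. [folklore] -/
theorem dipolePart_dipolePart (ψ : EuclideanSpace ℝ (Fin 3) → ℝ) (v : EuclideanSpace ℝ (Fin 3)) :
    dipolePart (dipolePart ψ) v = dipolePart ψ v :=
  dipolePart_dipole (dipoleProfile ψ) v

/-- **Radial (`ℓ = 0`) functions have no dipole part**: `Π₁(f ∘ |·|) = 0`. [folklore] -/
theorem dipolePart_radial (f : ℝ → ℝ) (v : EuclideanSpace ℝ (Fin 3)) :
    dipolePart (fun u => f ‖u‖) v = 0 := by
  unfold dipolePart
  rw [dipoleProfile_radial, inner_zero_left]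

/-- In particular `Π₁ Π₀ = 0` for the zonal average `Π₀`. [folklore] -/
theorem dipolePart_zonalAvg (ψ : EuclideanSpace ℝ (Fin 3) → ℝ) (v : EuclideanSpace ℝ (Fin 3)) :
    dipolePart (zonalAvg ψ) v = 0 :=
  dipolePart_radial (fun r => (4 * Real.pi)⁻¹ * ∫ ω : Metric.sphere (0 : EuclideanSpace ℝ (Fin 3)) 1,
    ψ (r • (ω : EuclideanSpace ℝ (Fin 3))) ∂sphereMeasure) v

/-- `Π₀ Π₁ = 0`: dipole parts have no zonal average. [folklore] -/
theorem zonalAvg_dipolePart (ψ : EuclideanSpace ℝ (Fin 3) → ℝ) (v : EuclideanSpace ℝ (Fin 3)) :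
    zonalAvg (dipolePart ψ) v = 0 := by
  unfold zonalAvg dipolePart
  rw [integral_sphere_eq_zero_of_odd, mul_zero]
  intro ω
  simp

/-- The dipole part is odd: `Π₁ψ(-v) = -Π₁ψ(v)`. [folklore] -/
theorem dipolePart_neg (ψ : EuclideanSpace ℝ (Fin 3) → ℝ) (v : EuclideanSpace ℝ (Fin 3)) :
    dipolePart ψ (-v) = -dipolePart ψ v := by
  unfold dipolePart
  rw [norm_neg, inner_neg_right]

/-- **Sup bound**: `|ψ| ≤ S` on the sphere `|u| = |v|` implies `|Π₁ψ(v)| ≤ 3 S`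
(`|Φ_ψ(r)| ≤ 3S/r`). [folklore] -/
theorem abs_dipolePart_le {ψ : EuclideanSpace ℝ (Fin 3) → ℝ} {v : EuclideanSpace ℝ (Fin 3)} {S : ℝ}
    (hS : ∀ u : EuclideanSpace ℝ (Fin 3), ‖u‖ = ‖v‖ → |ψ u| ≤ S) : |dipolePart ψ v| ≤ 3 * S := by
  have hS0 : 0 ≤ S := (abs_nonneg _).trans (hS v rfl)
  by_cases hv : v = 0
  · subst hv; simp [dipolePart]; linarith
  have hvn : 0 < ‖v‖ := norm_pos_iff.2 hv
  have h1 : ‖dipoleProfile ψ ‖v‖‖ ≤ 3 * S / ‖v‖ := norm_dipoleProfile_le hvn fun ω => hS _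
    (by rw [norm_smul, norm_norm, norm_eq_of_mem_sphere ω, mul_one])
  unfold dipolePart
  calc |⟪dipoleProfile ψ ‖v‖, v⟫_ℝ| ≤ ‖dipoleProfile ψ ‖v‖‖ * ‖v‖ := abs_real_inner_le_norm _ _
    _ ≤ 3 * S / ‖v‖ * ‖v‖ := mul_le_mul_of_nonneg_right h1 (norm_nonneg _)
    _ = 3 * S := div_mul_cancel₀ _ hvn.ne'

/-- Gaussian growth `|ψ| ≤ C e^{|·|²/4}` passes to the dipole part with constant `3C`. [folklore] -/
theorem abs_dipolePart_le_gauss {ψ : EuclideanSpace ℝ (Fin 3) → ℝ} {C : ℝ}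
    (hC : ∀ x, |ψ x| ≤ C * Real.exp (‖x‖ ^ 2 / 4)) (v : EuclideanSpace ℝ (Fin 3)) :
    |dipolePart ψ v| ≤ 3 * C * Real.exp (‖v‖ ^ 2 / 4) := by
  rw [mul_assoc]
  exact abs_dipolePart_le fun u hu => by rw [← hu]; exact hC u

/-- The dipole part of a measurable function is measurable. [folklore] -/
theorem measurable_dipolePart {ψ : EuclideanSpace ℝ (Fin 3) → ℝ} (hψ : Measurable ψ) :
    Measurable (dipolePart ψ) := by
  have hm : Measurable fun p : EuclideanSpace ℝ (Fin 3) × Metric.sphere (0 : EuclideanSpace ℝ (Fin 3)) 1 =>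
      ψ (‖p.1‖ • (p.2 : EuclideanSpace ℝ (Fin 3))) • (p.2 : EuclideanSpace ℝ (Fin 3)) :=
    (hψ.comp (by fun_prop : Continuous fun p : EuclideanSpace ℝ (Fin 3) ×
      Metric.sphere (0 : EuclideanSpace ℝ (Fin 3)) 1 => ‖p.1‖ • (p.2 : EuclideanSpace ℝ (Fin 3))).measurable).smul
      (by fun_prop : Continuous fun p : EuclideanSpace ℝ (Fin 3) ×
        Metric.sphere (0 : EuclideanSpace ℝ (Fin 3)) 1 => (p.2 : EuclideanSpace ℝ (Fin 3))).measurable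
  have hI := (hm.stronglyMeasurable.integral_prod_right'
    (ν := (sphereMeasure : Measure (Metric.sphere (0 : EuclideanSpace ℝ (Fin 3)) 1)))).measurable
  unfold dipolePart dipoleProfile
  exact ((by fun_prop : Measurable fun v : EuclideanSpace ℝ (Fin 3) => 3 / (4 * Real.pi * ‖v‖)).smul hI).inner
    measurable_id

/-- Linear functions are reproduced: `Π₁⟪m, ·⟫ = ⟪m, ·⟫`. [folklore] -/
theorem dipolePart_inner_const (m v : EuclideanSpace ℝ (Fin 3)) :
    dipolePart (fun u => ⟪m, u⟫_ℝ) v = ⟪m, v⟫_ℝ :=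
  dipolePart_dipole (fun _ => m) v

/-- Homogeneity `Π₁(cψ) = c Π₁ψ` (no integrability needed). [folklore] -/
theorem dipolePart_const_mul (c : ℝ) (ψ : EuclideanSpace ℝ (Fin 3) → ℝ) (v : EuclideanSpace ℝ (Fin 3)) :
    dipolePart (fun u => c * ψ u) v = c * dipolePart ψ v := by
  unfold dipolePart; rw [dipoleProfile_const_mul, real_inner_smul_left]

/-- Additivity `Π₁(ψ₁ + ψ₂) = Π₁ψ₁ + Π₁ψ₂` (both traces `σ`-integrable on the sphere `|u| = |v|`).
[folklore] -/
theorem dipolePart_add {ψ₁ ψ₂ : EuclideanSpace ℝ (Fin 3) → ℝ} {v : EuclideanSpace ℝ (Fin 3)}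
    (h₁ : Integrable (fun ω : Metric.sphere (0 : EuclideanSpace ℝ (Fin 3)) 1 =>
      ψ₁ (‖v‖ • (ω : EuclideanSpace ℝ (Fin 3)))) sphereMeasure)
    (h₂ : Integrable (fun ω : Metric.sphere (0 : EuclideanSpace ℝ (Fin 3)) 1 =>
      ψ₂ (‖v‖ • (ω : EuclideanSpace ℝ (Fin 3)))) sphereMeasure) :
    dipolePart (fun u => ψ₁ u + ψ₂ u) v = dipolePart ψ₁ v + dipolePart ψ₂ v := by
  unfold dipolePart; rw [dipoleProfile_add h₁ h₂, inner_add_left]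

/-- `Π₁(ψ₁ - ψ₂) = Π₁ψ₁ - Π₁ψ₂` (both traces `σ`-integrable on the sphere `|u| = |v|`). [folklore] -/
theorem dipolePart_sub {ψ₁ ψ₂ : EuclideanSpace ℝ (Fin 3) → ℝ} {v : EuclideanSpace ℝ (Fin 3)}
    (h₁ : Integrable (fun ω : Metric.sphere (0 : EuclideanSpace ℝ (Fin 3)) 1 =>
      ψ₁ (‖v‖ • (ω : EuclideanSpace ℝ (Fin 3)))) sphereMeasure)
    (h₂ : Integrable (fun ω : Metric.sphere (0 : EuclideanSpace ℝ (Fin 3)) 1 =>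
      ψ₂ (‖v‖ • (ω : EuclideanSpace ℝ (Fin 3)))) sphereMeasure) :
    dipolePart (fun u => ψ₁ u - ψ₂ u) v = dipolePart ψ₁ v - dipolePart ψ₂ v := by
  unfold dipolePart; rw [dipoleProfile_sub h₁ h₂, inner_sub_left]

/-- `Π₁(ψ - Π₁ψ) = 0` for `ψ` measurable of Gaussian growth. [folklore] -/
theorem dipolePart_sub_dipolePart {ψ : EuclideanSpace ℝ (Fin 3) → ℝ} (hψ : Measurable ψ) {C : ℝ}
    (hC : ∀ x, |ψ x| ≤ C * Real.exp (‖x‖ ^ 2 / 4)) (v : EuclideanSpace ℝ (Fin 3)) :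
    dipolePart (fun u => ψ u - dipolePart ψ u) v = 0 := by
  rw [dipolePart_sub (integrable_sphere_trace_of_gaussGrowth hψ hC v)
    (integrable_sphere_trace_of_gaussGrowth (measurable_dipolePart hψ) (abs_dipolePart_le_gauss hC) v),
    dipolePart_dipolePart, sub_self]

/-! ### The higher (`ℓ ≥ 2`) part `Π_{≥2} = 1 - Π₀ - Π₁` and its commutation with `L` -/

/-- **The higher (`ℓ ≥ 2`) part** `Π_{≥2}ψ := ψ - Π₀ψ - Π₁ψ` of a function on `ℝ³`: what is
left after removing the zonal average and the dipole part. [folklore] -/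
def higherPart (ψ : EuclideanSpace ℝ (Fin 3) → ℝ) (v : EuclideanSpace ℝ (Fin 3)) : ℝ :=
  ψ v - zonalAvg ψ v - dipolePart ψ v

/-- Measurability of `Π_{≥2}ψ`. [folklore] -/
theorem measurable_higherPart {ψ : EuclideanSpace ℝ (Fin 3) → ℝ} (hψ : Measurable ψ) :
    Measurable (higherPart ψ) :=
  (hψ.sub (measurable_zonalAvg hψ)).sub (measurable_dipolePart hψ)

/-- Gaussian growth of `ψ - Π₀ψ` with constant `2C`. [folklore] -/
theorem abs_sub_zonalAvg_le_gauss {ψ : EuclideanSpace ℝ (Fin 3) → ℝ} {C : ℝ}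
    (hC : ∀ x, |ψ x| ≤ C * Real.exp (‖x‖ ^ 2 / 4)) (x : EuclideanSpace ℝ (Fin 3)) :
    |ψ x - zonalAvg ψ x| ≤ 2 * C * Real.exp (‖x‖ ^ 2 / 4) := by
  have := abs_zonalAvg_le_gauss hC x
  have := hC x
  rw [two_mul, add_mul]
  exact (abs_sub _ _).trans (add_le_add ‹_› ‹_›)

/-- Gaussian growth of `Π_{≥2}ψ` with constant `5C`. [folklore] -/
theorem abs_higherPart_le_gauss {ψ : EuclideanSpace ℝ (Fin 3) → ℝ} {C : ℝ}
    (hC : ∀ x, |ψ x| ≤ C * Real.exp (‖x‖ ^ 2 / 4)) (x : EuclideanSpace ℝ (Fin 3)) :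
    |higherPart ψ x| ≤ 5 * C * Real.exp (‖x‖ ^ 2 / 4) := by
  have h1 := abs_sub_zonalAvg_le_gauss hC x
  have h2 := abs_dipolePart_le_gauss hC x
  unfold higherPart
  linarith [abs_sub (ψ x - zonalAvg ψ x) (dipolePart ψ x)]

/-- `Π₀ Π_{≥2} = 0` (Gaussian growth class). [folklore] -/
theorem zonalAvg_higherPart {ψ : EuclideanSpace ℝ (Fin 3) → ℝ} (hψ : Measurable ψ) {C : ℝ}
    (hC : ∀ x, |ψ x| ≤ C * Real.exp (‖x‖ ^ 2 / 4)) (v : EuclideanSpace ℝ (Fin 3)) :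
    zonalAvg (higherPart ψ) v = 0 := by
  have h1 := integrable_sphere_trace_of_gaussGrowth hψ hC v
  have h2 := integrable_sphere_trace_of_gaussGrowth (measurable_zonalAvg hψ) (abs_zonalAvg_le_gauss hC) v
  have h3 := integrable_sphere_trace_of_gaussGrowth (measurable_dipolePart hψ) (abs_dipolePart_le_gauss hC) v
  unfold higherPart
  rw [zonalAvg_sub (h1.sub h2) h3, zonalAvg_sub h1 h2, zonalAvg_zonalAvg, zonalAvg_dipolePart]
  ring

/-- `Π₁ Π_{≥2} = 0` (Gaussian growth class). [folklore] -/
theorem dipolePart_higherPart {ψ : EuclideanSpace ℝ (Fin 3) → ℝ} (hψ : Measurable ψ) {C : ℝ}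
    (hC : ∀ x, |ψ x| ≤ C * Real.exp (‖x‖ ^ 2 / 4)) (v : EuclideanSpace ℝ (Fin 3)) :
    dipolePart (higherPart ψ) v = 0 := by
  have h1 := integrable_sphere_trace_of_gaussGrowth hψ hC v
  have h2 := integrable_sphere_trace_of_gaussGrowth (measurable_zonalAvg hψ) (abs_zonalAvg_le_gauss hC) v
  have h3 := integrable_sphere_trace_of_gaussGrowth (measurable_dipolePart hψ) (abs_dipolePart_le_gauss hC) v
  unfold higherPart
  rw [dipolePart_sub (h1.sub h2) h3, dipolePart_sub h1 h2, dipolePart_zonalAvg, dipolePart_dipolePart]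
  ring

/-- **`L` commutes with the complementary projection `1 - Π₁`**:
`L(ψ - Π₁ψ)(v) = Lψ(v) - Π₁(Lψ)(v)` (Gaussian growth class). [folklore] -/
theorem hardSphereLinearizedOp_sub_dipolePart {ψ : EuclideanSpace ℝ (Fin 3) → ℝ} (hψ : Measurable ψ) {C : ℝ}
    (hC : ∀ x, |ψ x| ≤ C * Real.exp (‖x‖ ^ 2 / 4)) (v : EuclideanSpace ℝ (Fin 3)) :
    hardSphereLinearizedOp (fun u => ψ u - dipolePart ψ u) v =
      hardSphereLinearizedOp ψ v - dipolePart (hardSphereLinearizedOp ψ) v := by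
  rw [hardSphereLinearizedOp_sub_of_gaussGrowth hψ (measurable_dipolePart hψ) hC (abs_dipolePart_le_gauss hC),
    hardSphereLinearizedOp_dipolePart hψ hC]

/-- **`L` commutes with `Π_{≥2}`**: `L(Π_{≥2}ψ)(v) = Π_{≥2}(Lψ)(v)` for `ψ` measurable of Gaussian
growth and every `v` (Z1 + Z2 + additivity of `L` on the class). [folklore] -/
theorem hardSphereLinearizedOp_higherPart {ψ : EuclideanSpace ℝ (Fin 3) → ℝ} (hψ : Measurable ψ) {C : ℝ}
    (hC : ∀ x, |ψ x| ≤ C * Real.exp (‖x‖ ^ 2 / 4)) (v : EuclideanSpace ℝ (Fin 3)) :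
    hardSphereLinearizedOp (higherPart ψ) v = higherPart (hardSphereLinearizedOp ψ) v := by
  unfold higherPart
  rw [hardSphereLinearizedOp_sub_of_gaussGrowth (show Measurable fun u => ψ u - zonalAvg ψ u from
      hψ.sub (measurable_zonalAvg hψ)) (measurable_dipolePart hψ) (abs_sub_zonalAvg_le_gauss hC)
      (abs_dipolePart_le_gauss hC),
    hardSphereLinearizedOp_sub_zonalAvg hψ hC, hardSphereLinearizedOp_dipolePart hψ hC]

/-- **Registered helper `t12_hardSphereLinearizedOp_higherPart_comm`** (Z2'' of the corrector
plan): the `ℓ ≥ 2` remainder `Π_{≥2}ψ = ψ - Π₀ψ - Π₁ψ` commutes with the linearised hard-sphere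
operator on measurable functions of Gaussian growth, `L(Π_{≥2}ψ)(v) = Π_{≥2}(Lψ)(v)` for every `v`
— so that `u := Π_{≥2}ψ` solves `Lu = Π_{≥2}(Lψ)` exactly (the input of the far-field iteration).
(Stated with `higherPart` / `dipolePart` unfolded.) [folklore] -/
theorem t12_hardSphereLinearizedOp_higherPart_comm : ∀ (ψ : EuclideanSpace ℝ (Fin 3) → ℝ) (C : ℝ), Measurable ψ → (∀ x, |ψ x| ≤ C * Real.exp (‖x‖ ^ 2 / 4)) → ∀ v : EuclideanSpace ℝ (Fin 3), Literature.Analysis.UnboundedOperators.hardSphereLinearizedOp (fun u : EuclideanSpace ℝ (Fin 3) => ψ u - Summit.AtomisticToContinuum.HydrodynamicLimit.Theorems.ClampedCorrectorBirth.zonalAvg ψ u - inner ℝ (Summit.AtomisticToContinuum.HydrodynamicLimit.Theorems.ClampedCorrectorBirth.dipoleProfile ψ ‖u‖) u) v = Literature.Analysis.UnboundedOperators.hardSphereLinearizedOp ψ v - Summit.AtomisticToContinuum.HydrodynamicLimit.Theorems.ClampedCorrectorBirth.zonalAvg (Literature.Analysis.UnboundedOperators.hardSphereLinearizedOp ψ)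 v - inner ℝ (Summit.AtomisticToContinuum.HydrodynamicLimit.Theorems.ClampedCorrectorBirth.dipoleProfile (Literature.Analysis.UnboundedOperators.hardSphereLinearizedOp ψ) ‖v‖) v :=
  fun _ _ hψ hC v => hardSphereLinearizedOp_higherPart hψ hC v

/-! ### Z4': `M`-orthogonality bookkeeping of `Π₁` and `Π_{≥2}` -/

/-- `⟪Π₁ψ, φ⟫_M = 0` for radial `φ` (odd times even), for every `ψ`. [folklore] -/
theorem maxwellianInner_dipolePart_radial (ψ : EuclideanSpace ℝ (Fin 3) → ℝ) {φ : EuclideanSpace ℝ (Fin 3) → ℝ}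
    (hφ : ∀ u u' : EuclideanSpace ℝ (Fin 3), ‖u‖ = ‖u'‖ → φ u = φ u') :
    maxwellianInner (dipolePart ψ) φ = 0 := by
  rw [maxwellianInner_comm]
  exact maxwellianInner_eq_zero_of_even_odd (fun v => hφ _ _ (norm_neg v)) (dipolePart_neg ψ)

/-- Rotating the argument of `ψ` against a momentum weight: `∫ ψ(Av) ⟪b, v⟫ dM(v) = ∫ ψ(u) ⟪Ab, u⟫ dM(u)`
for a linear isometry `A` (`M` is `A`-invariant; no integrability needed). [folklore] -/
theorem integral_stdGaussian_comp_mul_inner (A : EuclideanSpace ℝ (Fin 3) ≃ₗᵢ[ℝ] EuclideanSpace ℝ (Fin 3))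
    (ψ : EuclideanSpace ℝ (Fin 3) → ℝ) (b : EuclideanSpace ℝ (Fin 3)) :
    ∫ v, ψ (A v) * ⟪b, v⟫_ℝ ∂stdGaussian (EuclideanSpace ℝ (Fin 3)) =
      ∫ u, ψ u * ⟪A b, u⟫_ℝ ∂stdGaussian (EuclideanSpace ℝ (Fin 3)) := by
  have h := maxwellianInner_comp_linearIsometryEquiv A ψ (fun u => ⟪A b, u⟫_ℝ)
  unfold maxwellianInner at h
  simpa only [Function.comp_apply, LinearIsometryEquiv.inner_map_map] using h

/-- The first `M`-moment `m_ψ = ∫ ψ(u) u dM(u)` exists for `ψ` measurable of Gaussian growth. [folklore] -/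
theorem integrable_smul_self_of_gaussGrowth {ψ : EuclideanSpace ℝ (Fin 3) → ℝ} (hψ : Measurable ψ) {C : ℝ}
    (hC : ∀ x, |ψ x| ≤ C * Real.exp (‖x‖ ^ 2 / 4)) :
    Integrable (fun u : EuclideanSpace ℝ (Fin 3) => ψ u • u) (stdGaussian (EuclideanSpace ℝ (Fin 3))) := by
  refine ((integrable_one_add_norm_mul_exp_sq_div_four_stdGaussian (E := EuclideanSpace ℝ (Fin 3))).const_mul
    C).mono' (hψ.smul measurable_id).aestronglyMeasurable (Eventually.of_forall fun u => ?_)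
  rw [norm_smul, Real.norm_eq_abs]
  calc |ψ u| * ‖u‖ ≤ C * Real.exp (‖u‖ ^ 2 / 4) * (1 + ‖u‖) :=
        mul_le_mul (hC u) (by linarith [norm_nonneg u]) (norm_nonneg _) ((abs_nonneg _).trans (hC u))
    _ = C * ((1 + ‖u‖) * Real.exp (‖u‖ ^ 2 / 4)) := by ring

/-- **Z4'b: `Π₁` is `M`-symmetric against the momentum invariants**, `⟪Π₁ψ, ⟪b, ·⟫⟫_M = ⟪ψ, ⟪b, ·⟫⟫_M`
for `ψ` measurable of Gaussian growth (orbit form, Fubini in `dM dR`, invariance of `M`, and the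
orbit form again for the linear function `⟪m_ψ, ·⟫` at the point `b`). [folklore] -/
theorem maxwellianInner_dipolePart_inner {ψ : EuclideanSpace ℝ (Fin 3) → ℝ} (hψ : Measurable ψ) {C : ℝ}
    (hC : ∀ x, |ψ x| ≤ C * Real.exp (‖x‖ ^ 2 / 4)) (b : EuclideanSpace ℝ (Fin 3)) :
    maxwellianInner (dipolePart ψ) (fun v => ⟪b, v⟫_ℝ) = maxwellianInner ψ (fun v => ⟪b, v⟫_ℝ) := by
  have hC0 : 0 ≤ C := le_trans (abs_nonneg _) ((hC 0).trans (by simp))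
  set m : EuclideanSpace ℝ (Fin 3) := ∫ u, ψ u • u ∂stdGaussian (EuclideanSpace ℝ (Fin 3)) with hm
  have hg : ∀ x : EuclideanSpace ℝ (Fin 3),
      ∫ u, ψ u * ⟪x, u⟫_ℝ ∂stdGaussian (EuclideanSpace ℝ (Fin 3)) = ⟪m, x⟫_ℝ := fun x => by
    rw [hm, real_inner_comm, ← integral_inner (integrable_smul_self_of_gaussGrowth hψ hC) x]
    simp_rw [real_inner_smul_right]
  -- Fubini in `dM dR`
  have hint : Integrable (Function.uncurry fun (v : EuclideanSpace ℝ (Fin 3))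
      (R : unitary (EuclideanSpace ℝ (Fin 3) →L[ℝ] EuclideanSpace ℝ (Fin 3))) =>
      3 * (rotTrace R * ψ (haarRot R v)) * ⟪b, v⟫_ℝ)
      ((stdGaussian (EuclideanSpace ℝ (Fin 3))).prod (Measure.haarMeasure ⊤)) := by
    refine ((((integrable_one_add_norm_mul_exp_sq_div_four_stdGaussian (E := EuclideanSpace ℝ (Fin 3))).const_mul
      (9 * C * ‖b‖)).comp_fst (Measure.haarMeasure ⊤)).mono' ?_ (Eventually.of_forall fun p => ?_))
    · exact ((((continuous_rotTrace.comp continuous_snd).measurable.mul (hψ.comp (continuous_haarRot_apply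
        continuous_snd continuous_fst).measurable)).const_mul 3).mul
        (continuous_const.inner continuous_fst).measurable).aestronglyMeasurable
    · rw [Function.uncurry_apply_pair, Real.norm_eq_abs, abs_mul, abs_mul, abs_mul,
        abs_of_pos (by norm_num : (0 : ℝ) < 3)]
      have h1 := hC (haarRot p.2 p.1)
      rw [LinearIsometryEquiv.norm_map] at h1
      have h2 : |⟪b, p.1⟫_ℝ| ≤ ‖b‖ * (1 + ‖p.1‖) :=
        (abs_real_inner_le_norm _ _).trans (by nlinarith [norm_nonneg b, norm_nonneg p.1])
      calc 3 * (|rotTrace p.2| * |ψ (haarRot p.2 p.1)|) * |⟪b, p.1⟫_ℝ|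
          ≤ 3 * (3 * (C * Real.exp (‖p.1‖ ^ 2 / 4))) * (‖b‖ * (1 + ‖p.1‖)) :=
            mul_le_mul (mul_le_mul_of_nonneg_left (mul_le_mul (abs_rotTrace_le _) h1 (abs_nonneg _)
              (by norm_num)) (by norm_num)) h2 (abs_nonneg _)
              (mul_nonneg (by norm_num) (mul_nonneg (by norm_num) (mul_nonneg hC0 (Real.exp_pos _).le)))
        _ = 9 * C * ‖b‖ * ((1 + ‖p.1‖) * Real.exp (‖p.1‖ ^ 2 / 4)) := by ring
  have hrot : ∀ R : unitary (EuclideanSpace ℝ (Fin 3) →L[ℝ] EuclideanSpace ℝ (Fin 3)),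
      ∫ v, 3 * (rotTrace R * ψ (haarRot R v)) * ⟪b, v⟫_ℝ ∂stdGaussian (EuclideanSpace ℝ (Fin 3)) =
        3 * (rotTrace R * ⟪m, haarRot R b⟫_ℝ) := by
    intro R
    have e : ∀ v, 3 * (rotTrace R * ψ (haarRot R v)) * ⟪b, v⟫_ℝ =
        3 * rotTrace R * (ψ (haarRot R v) * ⟪b, v⟫_ℝ) := fun v => by ring
    simp_rw [e]
    rw [integral_const_mul, integral_stdGaussian_comp_mul_inner, hg, mul_assoc]
  have horb := dipolePart_eq_integral_haar (ψ := fun x => ⟪m, x⟫_ℝ)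
    (continuous_const.inner continuous_id).measurable b (M := ‖m‖ * ‖b‖)
    fun u hu => by rw [← hu]; exact abs_real_inner_le_norm m u
  rw [dipolePart_inner_const] at horb
  unfold maxwellianInner
  simp_rw [dipolePart_eq_integral_haar_of_gaussGrowth hψ hC]
  have e2 : ∀ v : EuclideanSpace ℝ (Fin 3), (3 * ∫ R, rotTrace R * ψ (haarRot R v) ∂Measure.haarMeasure ⊤) *
      ⟪b, v⟫_ℝ = ∫ R, 3 * (rotTrace R * ψ (haarRot R v)) * ⟪b, v⟫_ℝ ∂Measure.haarMeasure ⊤ := fun v => by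
    rw [← integral_const_mul, ← integral_mul_const]
  simp_rw [e2]
  rw [integral_integral_swap hint]
  change ∫ R, ∫ v, 3 * (rotTrace R * ψ (haarRot R v)) * ⟪b, v⟫_ℝ ∂stdGaussian (EuclideanSpace ℝ (Fin 3))
    ∂Measure.haarMeasure ⊤ = _
  simp_rw [hrot]
  rw [integral_const_mul, ← horb, ← hg]

/-- **Registered helper `t12_dipolePart_orthogonal_collisionInvariants`** (Z4' of the corrector
plan): the dipole projection preserves `M`-orthogonality to the collision invariants
`span{1, v, |v|²}` — if `ψ ⊥_M` all invariants then so is `Π₁ψ` (it kills the radial ones `1, |v|²`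
by parity and is `M`-symmetric against the momentum components). Hence the `ℓ = 1` sector of the
orthogonal pre-image stays orthogonal, which fixes its free (momentum) constant.
(Stated with `dipolePart` unfolded.) [folklore] -/
theorem t12_dipolePart_orthogonal_collisionInvariants : ∀ (ψ : EuclideanSpace ℝ (Fin 3) → ℝ) (C : ℝ), Measurable ψ → (∀ x, |ψ x| ≤ C * Real.exp (‖x‖ ^ 2 / 4)) → (∀ φ ∈ Literature.Analysis.UnboundedOperators.collisionInvariants (EuclideanSpace ℝ (Fin 3)), Literature.Analysis.UnboundedOperators.maxwellianInner ψ φ = 0) → ∀ φ ∈ Literature.Analysis.UnboundedOperators.collisionInvariants (EuclideanSpace ℝ (Fin 3)), Literature.Analysis.UnboundedOperators.maxwellianInner (fun u : EuclideanSpace ℝ (Fin 3) => inner ℝ (Summit.AtomisticToContinuum.HydrodynamicLimit.Theorems.ClampedCorrectorBirth.dipoleProfile ψ ‖u‖) u) φ = 0 := by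
  intro ψ C hψ hC horth φ hφ
  obtain ⟨a, c, b, rfl⟩ := mem_collisionInvariants_iff.1 hφ
  change maxwellianInner (dipolePart ψ) _ = 0
  have hsplit : (fun v : EuclideanSpace ℝ (Fin 3) => a + ⟪b, v⟫_ℝ + c * ‖v‖ ^ 2) =
      (fun v : EuclideanSpace ℝ (Fin 3) => a + c * ‖v‖ ^ 2) + fun v : EuclideanSpace ℝ (Fin 3) => ⟪b, v⟫_ℝ := by
    funext v; simp only [Pi.add_apply]; ring
  have hrad : ∀ x : EuclideanSpace ℝ (Fin 3), |a + c * ‖x‖ ^ 2| ≤ (|a| + |c|) * (1 + ‖x‖) ^ 2 := fun x => by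
    refine (abs_add_le _ _).trans ?_
    rw [abs_mul, abs_of_nonneg (by positivity : (0 : ℝ) ≤ ‖x‖ ^ 2)]
    nlinarith [abs_nonneg a, abs_nonneg c, norm_nonneg x, mul_nonneg (abs_nonneg c) (norm_nonneg x)]
  have hlin : ∀ x : EuclideanSpace ℝ (Fin 3), |⟪b, x⟫_ℝ| ≤ ‖b‖ * (1 + ‖x‖) ^ 1 := fun x =>
    (abs_real_inner_le_norm b x).trans (by nlinarith [norm_nonneg b, norm_nonneg x])
  have hDm := measurable_dipolePart hψ
  have hDC := abs_dipolePart_le_gauss hC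
  rw [hsplit, maxwellianInner_add_right
      (integrable_mul_of_gaussGrowth_of_polyGrowth hDm (by fun_prop) hDC hrad)
      (integrable_mul_of_gaussGrowth_of_polyGrowth hDm (by fun_prop) hDC hlin),
    maxwellianInner_dipolePart_radial ψ (fun u u' h => by simp only [h]), zero_add,
    maxwellianInner_dipolePart_inner hψ hC]
  exact horth _ (mem_collisionInvariants_iff.2 ⟨0, 0, b, by funext v; simp⟩)

/-- **The higher part is `M`-orthogonal to every collision invariant, for every `ψ`** measurable of
Gaussian growth: `⟪Π_{≥2}ψ, a + ⟪b, ·⟫ + c|·|²⟫_M = 0` (`Π₀`, `Π₁` are `M`-symmetric against the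
radial resp. momentum invariants and kill the others). [folklore] -/
theorem maxwellianInner_higherPart_collisionInvariant {ψ : EuclideanSpace ℝ (Fin 3) → ℝ} (hψ : Measurable ψ)
    {C : ℝ} (hC : ∀ x, |ψ x| ≤ C * Real.exp (‖x‖ ^ 2 / 4)) :
    ∀ φ ∈ collisionInvariants (EuclideanSpace ℝ (Fin 3)), maxwellianInner (higherPart ψ) φ = 0 := by
  intro φ hφ
  obtain ⟨a, c, b, rfl⟩ := mem_collisionInvariants_iff.1 hφ
  have hsplit : (fun v : EuclideanSpace ℝ (Fin 3) => a + ⟪b, v⟫_ℝ + c * ‖v‖ ^ 2) =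
      (fun v : EuclideanSpace ℝ (Fin 3) => a + c * ‖v‖ ^ 2) + fun v : EuclideanSpace ℝ (Fin 3) => ⟪b, v⟫_ℝ := by
    funext v; simp only [Pi.add_apply]; ring
  have hrad : ∀ x : EuclideanSpace ℝ (Fin 3), |a + c * ‖x‖ ^ 2| ≤ (|a| + |c|) * (1 + ‖x‖) ^ 2 := fun x => by
    refine (abs_add_le _ _).trans ?_
    rw [abs_mul, abs_of_nonneg (by positivity : (0 : ℝ) ≤ ‖x‖ ^ 2)]
    nlinarith [abs_nonneg a, abs_nonneg c, norm_nonneg x, mul_nonneg (abs_nonneg c) (norm_nonneg x)]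
  have hlin : ∀ x : EuclideanSpace ℝ (Fin 3), |⟪b, x⟫_ℝ| ≤ ‖b‖ * (1 + ‖x‖) ^ 1 := fun x =>
    (abs_real_inner_le_norm b x).trans (by nlinarith [norm_nonneg b, norm_nonneg x])
  have hradm : Measurable fun v : EuclideanSpace ℝ (Fin 3) => a + c * ‖v‖ ^ 2 := by fun_prop
  have hlinm : Measurable fun v : EuclideanSpace ℝ (Fin 3) => ⟪b, v⟫_ℝ := by fun_prop
  -- the three pieces ψ, Π₀ψ, Π₁ψ and their integrability against both weights
  have hZm := measurable_zonalAvg hψ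
  have hZC := abs_zonalAvg_le_gauss hC
  have hDm := measurable_dipolePart hψ
  have hDC := abs_dipolePart_le_gauss hC
  have hSm : Measurable fun u => ψ u - zonalAvg ψ u := hψ.sub hZm
  have hSC := abs_sub_zonalAvg_le_gauss hC
  have I : ∀ {f : EuclideanSpace ℝ (Fin 3) → ℝ}, Measurable f → ∀ {D : ℝ},
      (∀ x, |f x| ≤ D * Real.exp (‖x‖ ^ 2 / 4)) →
      Integrable (fun v => f v * (a + c * ‖v‖ ^ 2)) (stdGaussian (EuclideanSpace ℝ (Fin 3))) ∧
        Integrable (fun v => f v * ⟪b, v⟫_ℝ) (stdGaussian (EuclideanSpace ℝ (Fin 3))) := fun hf _ hD =>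
    ⟨integrable_mul_of_gaussGrowth_of_polyGrowth hf hradm hD hrad,
      integrable_mul_of_gaussGrowth_of_polyGrowth hf hlinm hD hlin⟩
  have hH : higherPart ψ = (fun u => ψ u - zonalAvg ψ u) - dipolePart ψ := rfl
  have hS : (fun u => ψ u - zonalAvg ψ u) = ψ - zonalAvg ψ := rfl
  rw [hsplit, maxwellianInner_add_right (I (measurable_higherPart hψ) (abs_higherPart_le_gauss hC)).1
      (I (measurable_higherPart hψ) (abs_higherPart_le_gauss hC)).2, hH,
    maxwellianInner_sub_left (I hSm hSC).1 (I hDm hDC).1, maxwellianInner_sub_left (I hSm hSC).2 (I hDm hDC).2,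
    hS, maxwellianInner_sub_left (I hψ hC).1 (I hZm hZC).1, maxwellianInner_sub_left (I hψ hC).2 (I hZm hZC).2,
    maxwellianInner_zonalAvg_radial hψ hC hradm (fun u u' h => by simp only [h]) hrad,
    maxwellianInner_zonalAvg_inner, maxwellianInner_dipolePart_radial ψ (fun u u' h => by simp only [h]),
    maxwellianInner_dipolePart_inner hψ hC]
  ring

end Summit.AtomisticToContinuum.HydrodynamicLimit.Theorems.ClampedCorrectorBirth
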